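import Literature.Geometry.Lorentzian.HonestNearKerrLeaf
import HarnessLib

/-!
# Sound near-Kerr leaves: `CauchyDevelopment.IsSoundNearKerrLeaf` (the repaired leaf predicate,
# second revision — SUPERSEDES `IsHonestNearKerrLeaf` of `HonestNearKerrLeaf.lean`)

`HonestNearKerrLeaf.lean` (p124187) proposed `IsHonestNearKerrLeaf` = the typed block of
`CauchyDevelopment.IsNearKerrLeaf` plus (H₁) thick discs `2Mᵢ ≤ Rᵢ`, (H₂) SLAB-TO-SLAB overlaps,
(H₃) flat-frame tube separation, (H₄) achronality of the whole leaf `S`.  Two of these are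
OVER-STRONG — they are unsatisfiable by the intended geometry as soon as `N ≥ 1`:

* (H₂) asks the certified Kerr annulus `Ψᵢ{t*ᵢ = 0, ρᵢ < rᵢ ≤ Rᵢ}` and the certified flat sheet
  `Ψ₀{t₀ = 0}` to CONTAIN one another on the overlap, i.e. to coincide there as hypersurfaces of
  `𝒟`.  But a hypersurface has ONE second fundamental form: the flat chart (deviation `≤ ε` in `Cᵏ`,
  `k ≥ 1`, transversal jet included) makes it `ε`-close to that of the unit hyperboloid of
  Minkowski space — umbilic with all principal curvatures `1` in the leaf's unit — while the hole
  chart makes it `ε`-close to that of the Kerr–Schild slice `{t* = 0}` at radius `r ≍ R`, of size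
  `≍ M/R²`.  So `M/R² ≍ 1`, and with `k ≥ 2` the curvature of the same region is both `≲ ε` (flat
  chart) and `≍ M/R³ ≍ M^{-1/2}` (Kerr): impossible once `ε ≪ min (1, m₀²)`.  Hence every honest leaf
  with `N ≥ 1`, `k ≥ 2` and small `ε` fails to exist, and items over `IsHonestNearKerrLeaf` are
  VACUOUS in every black-hole sector (their hypotheses quantify over all `k` and all `ε > 0`).
* (H₄) asks `S = sheet ∪ discs` to be achronal; over each overlap annulus the sheet and the disc are
  two different hypersurfaces (by the previous point), one slightly to the future of the other, so
  `S` is never achronal for `N ≥ 1`.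

The intended honesty is obtained instead by certifying the charts on OPEN 4-DIMENSIONAL LAYERS and
keeping the typed (topological) overlap clauses, which then relate two `ε`-isometric charts of a
common open region — honest relative kinematics, transition maps `ε`-close to Poincaré motions — while
the annuli stay thin (`Rᵢ − ρᵢ ≲` layer thickness) and the two slicings near a hole may differ, as in
every hyperboloidal/near-zone gluing of the literature.  `IsSoundNearKerrLeaf 𝒟 k ε N M a S` :=
the typed block VERBATIM plus

* (S₁) THICK HONEST DISCS `2 Mᵢ ≤ Rᵢ` (against fake / phantom labels, `NearKerrLeafMinkowskiFakeHoles`);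
* (S₂) NEAR-ZONE LAYER CERTIFICATION: the `Cᵏ` sup of the hole chart's deviation from boosted Kerr
  over the whole near-zone LAYER `{−1 < t*ᵢ < 1, rᵢ ≤ Rᵢ}` (not only the slab `{t*ᵢ = 0}`) is `≤ ε`;
* (S₃) FLAT LAYER CERTIFICATION: the `Cᵏ` sup of the flat chart's deviation from `η` over the whole
  layer `L₀ = {−1 < t₀ < 1} ∩ U₀` is `≤ ε` (against the topological-overlap defect, crux `Capture`
  NOTES L8 (B): both overlap clauses now land in honestly charted open sets);
* (S₄) FLAT-FRAME TUBE SEPARATION (as (H₃));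
* (S₅) ACHRONALITY OF THE FLAT SHEET `Ψ₀{t₀ = 0}` (against the DODGE and the time-stretch,
  `NearKerrLeafMinkowski{Dodge,Boosted,BoostedDodge}`, `Minkowski.exists_isNearKerrLeaf_not_achronal`:
  an achronal entire sheet is a `1`-Lipschitz graph of the asymptotic chart and is crossed by every
  timelike line — `achronal_abs_time_sub_le`, `stub_lipschitzGraphCrossed`, p124058).

Proved here: sound ⇒ typed; monotonicity in `(k, ε)`; for `N = 0`, sound ⇒ `S` achronal; and
ANTI-VACUITY at `N = 0`: the honest unit hyperboloid of the Minkowski development with the identity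
chart is a sound `(0, k)`-leaf with `0` holes for every `k` (`Minkowski.isSoundNearKerrLeaf_hyperboloid`;
the layer deviation of the identity chart vanishes identically).  Anti-vacuity for `N ≥ 1` needs a
black-hole development and is not available in the tree (none is constructed); on paper the intended
late-time leaves of a sub-extremal Kerr exterior (Kerr-star near zone of radius `R ≍ (M/ε)^{1/3}`, thin
annulus, hyperboloidal sheet of unit `≫ R`) satisfy (S₁)–(S₅).  Nothing here is asserted about any
item; adopting the predicate is a planner's `route edit` (crux `Capture` NOTES L30, corrected L36).

## References

* B. O'Neill, *Semi-Riemannian Geometry*, Academic Press 1983, Ch. 4, Prop. 4.33 (shape operator of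
  hyperquadrics: the unit hyperboloid is totally umbilic) and Ch. 14, pp. 402, 413.
  [ONeillSemiRiemannian1983]
* M. Dafermos, G. Holzegel, I. Rodnianski, M. Taylor, arXiv:2104.08222, §1 (chart / deviation
  vocabulary; near-zone and hyperboloidal regions). [DafermosHolzegelRodnianskiTaylor2021]
-/

noncomputable section

open Set TopologicalSpace Filter Topology
open scoped Manifold ContDiff Topology ENNReal

universe u

namespace Literature.Geometry.Lorentzian

namespace CauchyDevelopment

variable {X : Type u} [TopologicalSpace X] [ChartedSpace E3 X] [IsManifold (𝓡 3) ∞ X]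
  [ConnectedSpace X] {D : InitialDataSet (𝓡 3) X}

/-- **`S` is a SOUND `(ε, k)`-near-Kerr leaf of `𝒟` with `N` holes of masses `M` and spins `a`**:
the block of `CauchyDevelopment.IsNearKerrLeaf` verbatim (same thirteen witnesses, same twenty
clauses), followed by (S₁) `2 Mᵢ ≤ Rᵢ`, (S₂) `Cᵏ` certification of each hole chart on its whole
near-zone LAYER `{x ∈ Lᵢ | rᵢ ≤ Rᵢ}`, (S₃) `Cᵏ` certification of the flat chart on its whole layer
`L₀`, (S₄) pairwise disjointness of the flat-frame near-zone tubes `{−1 < t₀ < 1, rᵢ ≤ Rᵢ} ⊆ E4`, and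
(S₅) achronality of the flat SHEET `Ψ₀ '' {t₀ = 0}`.  Second revision of the repaired predicate; see
the module docstring for why the first revision's slab-to-slab overlaps and whole-leaf achronality
were over-strong. DHRT arXiv:2104.08222, §1 (vocabulary); O'Neill 1983, Ch. 14, p. 413 (achronal
sets). [cite: DafermosHolzegelRodnianskiTaylor2021, §1] -/
def IsSoundNearKerrLeaf (𝒟 : CauchyDevelopment D) (k : ℕ) (ε : ℝ≥0∞) (N : ℕ) (M a : Fin N → ℝ)
    (S : Set 𝒟.carrier) : Prop :=
  ∃ (R ρ : Fin N → ℝ) (mo : Fin N → lorentzGroup × E4) (r : Fin N → E4 → ℝ)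
    (B : Fin N → ModelBackground) (U₀ : Opens E4) (B₀ : ModelBackground)
    (Ψ : ∀ i, (B i).domain → 𝒟.carrier) (Ψ₀ : B₀.domain → 𝒟.carrier)
    (L W : ∀ i, Set (B i).domain) (L₀ W₀ : Set B₀.domain),
    (∀ i, r i = fun x => Kerr.radius (a i) (poincareInv (mo i).1 (mo i).2 x)) ∧
    (∀ i, B i = starBackground (mo i).1 (mo i).2 (M i) (a i) (r i)) ∧
    B₀ = hypBackground U₀ ∧
    (∀ i, L i = {x | -1 < (B i).time x.1 ∧ (B i).time x.1 < 1 ∧ (B i).radius x.1 < R i + 1} ∧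
      W i = {x | 0 < (B i).time x.1 ∧ (B i).time x.1 < 1 ∧ (B i).radius x.1 ≤ R i}) ∧
    L₀ = {x | -1 < B₀.time x.1 ∧ B₀.time x.1 < 1} ∧
    W₀ = {x | 0 < B₀.time x.1 ∧ B₀.time x.1 < 1} ∧
    (∀ i, 0 < M i ∧ |a i| ≤ M i ∧ 0 < ρ i ∧ ρ i < R i) ∧
    {x : E4 | -1 < x 0 - Real.sqrt (1 + E4.spatialNorm x ^ 2) ∧ ∀ i, ρ i < r i x} ⊆
      (U₀ : Set E4) ∧
    (∀ i, ContMDiffOn 𝓘(ℝ, E4) (𝓡 4) ∞ (Ψ i) (L i) ∧ IsOpenEmbedding ((L i).restrict (Ψ i)) ∧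
      Ψ i '' L i ⊆ 𝒟.metric.causalFuture 𝒟.timeOrientation (range 𝒟.embed)) ∧
    ContMDiffOn 𝓘(ℝ, E4) (𝓡 4) ∞ Ψ₀ L₀ ∧ IsOpenEmbedding (L₀.restrict Ψ₀) ∧
    Ψ₀ '' L₀ ⊆ 𝒟.metric.causalFuture 𝒟.timeOrientation (range 𝒟.embed) ∧
    (∀ i, 𝒟.toSpacetime.truncDeviationCk (B i) (Ψ i) k (R i) 0 ≤ ε) ∧
    𝒟.toSpacetime.deviationCk B₀ Ψ₀ k 0 ≤ ε ∧
    Pairwise (Function.onFun Disjoint fun i => Ψ i '' {x | x ∈ L i ∧ (B i).radius x.1 ≤ R i}) ∧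
    (∀ i, Ψ i '' {x | (B i).time x.1 = 0 ∧ ρ i < (B i).radius x.1 ∧ (B i).radius x.1 ≤ R i} ⊆
      Ψ₀ '' L₀) ∧
    (∀ i, Ψ₀ '' {x | B₀.time x.1 = 0 ∧ ρ i < r i x.1 ∧ r i x.1 < R i} ⊆ Ψ i '' L i) ∧
    S = Ψ₀ '' B₀.timeSlab 0 ∪ ⋃ i, Ψ i '' (B i).truncTimeSlab (R i) 0 ∧
    Ψ₀ '' W₀ ∪ ⋃ i, Ψ i '' W i ⊆ 𝒟.metric.chronologicalFuture 𝒟.timeOrientation S ∧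
    𝒟.exteriorOf (Ψ₀ '' W₀ ∪ ⋃ i, Ψ i '' W i) \ (Ψ₀ '' W₀ ∪ ⋃ i, Ψ i '' W i) ⊆
      𝒟.metric.causalPast 𝒟.timeOrientation S ∧
    -- (S₁) thick honest discs: no fake / phantom labels
    (∀ i, 2 * M i ≤ R i) ∧
    -- (S₂) near-zone LAYER certification of the hole charts
    (∀ i, supCkENorm (Subtype.val '' {x : (B i).domain | x ∈ L i ∧ (B i).radius x.1 ≤ R i}) k
      (𝒟.toSpacetime.deviationExtend (B i) (Ψ i)) ≤ ε) ∧
    -- (S₃) LAYER certification of the flat chart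
    supCkENorm (Subtype.val '' L₀) k (𝒟.toSpacetime.deviationExtend B₀ Ψ₀) ≤ ε ∧
    -- (S₄) the near-zone tubes are pairwise disjoint IN THE FLAT FRAME on the hyperboloidal layer
    Pairwise (Function.onFun Disjoint fun i =>
      {x : E4 | -1 < x 0 - Real.sqrt (1 + E4.spatialNorm x ^ 2) ∧
        x 0 - Real.sqrt (1 + E4.spatialNorm x ^ 2) < 1 ∧ r i x ≤ R i}) ∧
    -- (S₅) the flat SHEET is achronal
    𝒟.metric.IsAchronal 𝒟.timeOrientation (Ψ₀ '' B₀.timeSlab 0)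

namespace IsSoundNearKerrLeaf

variable {𝒟 : CauchyDevelopment D} {k k' : ℕ} {ε ε' : ℝ≥0∞} {N : ℕ} {M a : Fin N → ℝ}
  {S : Set 𝒟.carrier}

/-- Sound leaves are typed leaves (projection onto the block of `IsNearKerrLeaf`, same charts).
[cite: DafermosHolzegelRodnianskiTaylor2021, §1] -/
theorem isNearKerrLeaf (h : 𝒟.IsSoundNearKerrLeaf k ε N M a S) : 𝒟.IsNearKerrLeaf k ε N M a S := by
  obtain ⟨R, ρ, mo, r, B, U₀, B₀, Ψ, Ψ₀, L, W, L₀, W₀, h1, h2, h3, h4, h5, h6, h7, h8, h9, h10, h11,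
    h12, h13, h14, h15, h16, h17, h18, h19, h20, -⟩ := h
  exact ⟨R, ρ, mo, r, B, U₀, B₀, Ψ, Ψ₀, L, W, L₀, W₀, h1, h2, h3, h4, h5, h6, h7, h8, h9, h10, h11,
    h12, h13, h14, h15, h16, h17, h18, h19, h20⟩

/-- The holes of a sound leaf have positive masses and `|aᵢ| ≤ Mᵢ` (parameter clause).
[cite: DafermosHolzegelRodnianskiTaylor2021, §1] -/
theorem mass_pos_and_abs_spin_le (h : 𝒟.IsSoundNearKerrLeaf k ε N M a S) (i : Fin N) :
    0 < M i ∧ |a i| ≤ M i :=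
  h.isNearKerrLeaf.mass_pos_and_abs_spin_le i

/-- With NO holes a sound leaf IS its flat sheet, hence achronal (clause (S₅)). O'Neill 1983,
Ch. 14, p. 413. [cite: ONeillSemiRiemannian1983, Ch. 14, p. 413] -/
theorem isAchronal_of_zero {M a : Fin 0 → ℝ} (h : 𝒟.IsSoundNearKerrLeaf k ε 0 M a S) :
    𝒟.metric.IsAchronal 𝒟.timeOrientation S := by
  obtain ⟨R, ρ, mo, r, B, U₀, B₀, Ψ, Ψ₀, L, W, L₀, W₀, -, -, -, -, -, -, -, -, -, -, -, -, -, -, -, -,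
    -, hS, -, -, -, -, -, -, hach⟩ := h
  have : S = Ψ₀ '' B₀.timeSlab 0 := by rw [hS, iUnion_of_empty, union_empty]
  rw [this]
  exact hach

/-- **Monotonicity in `(k, ε)`**: a sound `(ε, k')`-leaf is a sound `(ε', k)`-leaf for `k ≤ k'`,
`ε ≤ ε'`, with the same charts (`supCkENorm_mono_right`, also for the two layer clauses).
[cite: DafermosHolzegelRodnianskiTaylor2021, §1] -/
theorem mono (h : 𝒟.IsSoundNearKerrLeaf k' ε N M a S) (hk : k ≤ k') (hε : ε ≤ ε') :
    𝒟.IsSoundNearKerrLeaf k ε' N M a S := by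
  obtain ⟨R, ρ, mo, r, B, U₀, B₀, Ψ, Ψ₀, L, W, L₀, W₀, hr, hB, hB₀, hLW, hL₀, hW₀, hpar, hU₀, hΨ,
    hΨ₀, hΨ₀e, hΨ₀J, hdev, hdev₀, h15, h16, h17, h18, h19, h20, hS1, hS2, hS3, hS4, hS5⟩ := h
  exact ⟨R, ρ, mo, r, B, U₀, B₀, Ψ, Ψ₀, L, W, L₀, W₀, hr, hB, hB₀, hLW, hL₀, hW₀, hpar, hU₀, hΨ,
    hΨ₀, hΨ₀e, hΨ₀J, fun i ↦ ((supCkENorm_mono_right _ hk _).trans (hdev i)).trans hε,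
    ((supCkENorm_mono_right _ hk _).trans hdev₀).trans hε, h15, h16, h17, h18, h19, h20, hS1,
    fun i ↦ ((supCkENorm_mono_right _ hk _).trans (hS2 i)).trans hε,
    ((supCkENorm_mono_right _ hk _).trans hS3).trans hε, hS4, hS5⟩

end IsSoundNearKerrLeaf

end CauchyDevelopment

/-! ### Anti-vacuity at `N = 0`: the honest unit hyperboloid of the Minkowski development -/

namespace Minkowski

/-- **ANTI-VACUITY of the sound predicate at `N = 0`**: the honest unit hyperboloid `stretchLeaf 1`
of the Minkowski development, charted by the identity `stretchChart 1` on `U₀ = ⊤`, is a SOUND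
`(0, k)`-near-Kerr leaf with `0` holes for every `k`: the twenty typed clauses as in
`isNearKerrLeaf_hyperboloid_fakeHoles` (case `N = 0`: smooth open embedding of the layer, layer image in
`J⁺({x⁰ = 0})`, zero slab deviation, upper layer in `I⁺(S)`, honest barrier clause
`barrier_hyperboloid`); (S₁), (S₂), (S₄) quantify over `Fin 0`; (S₃) the LAYER deviation of the
identity chart is the constant `stretchDefect 1 = 0`; (S₅) `isAchronal_stretchLeaf_one`.
[cite: ONeillSemiRiemannian1983, Ch. 14, p. 413] -/
theorem isSoundNearKerrLeaf_hyperboloid (k : ℕ) :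
    vacuumCauchyDevelopment.toCauchyDevelopment.IsSoundNearKerrLeaf k 0 0 ![] ![] (stretchLeaf 1) := by
  -- the flat layer
  set L₀ : Set (hypBackground ⊤).domain :=
    {x | -1 < (hypBackground ⊤).time x.1 ∧ (hypBackground ⊤).time x.1 < 1} with hL₀
  have hL₀open : IsOpen L₀ :=
    isOpen_Ioo.preimage (continuous_hypTime.comp continuous_subtype_val)
  refine ⟨![], ![], Fin.elim0, Fin.elim0, Fin.elim0, ⊤, hypBackground ⊤, fun i => i.elim0,
    stretchChart 1, fun i => i.elim0, fun i => i.elim0, L₀,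
    {x | 0 < (hypBackground ⊤).time x.1 ∧ (hypBackground ⊤).time x.1 < 1},
    fun i => i.elim0, fun i => i.elim0, rfl, fun i => i.elim0, rfl, rfl, fun i => i.elim0,
    fun x _ => trivial, fun i => i.elim0, (contMDiff_stretchChart 1).contMDiffOn, ?_, ?_,
    fun i => i.elim0, ?_, fun i => i.elim0, fun i => i.elim0, fun i => i.elim0, ?_, ?_, ?_,
    fun i => i.elim0, fun i => i.elim0, ?_, fun i => i.elim0, isAchronal_stretchLeaf_one⟩
  · -- flat chart: open embedding of the layer
    have h := (timeStretchEquiv 1 one_ne_zero).toHomeomorph.isOpenEmbedding.comp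
      ((IsOpen.isOpenEmbedding_subtypeVal (⊤ : Opens E4).2).comp
        hL₀open.isOpenEmbedding_subtypeVal)
    exact h
  · -- flat chart: layer image in `J⁺({x⁰ = 0})`
    rintro _ ⟨x, hx, rfl⟩
    have hx0 : 0 < x.1 0 := pos_of_neg_one_lt_hypTime hx.1
    set p : E4 := E4.ofTimeSpace 0 (E4.spatial (timeStretch 1 x.1)) with hp
    have hpr : p ∈ range vacuumCauchyDevelopment.toCauchyDevelopment.embed := by
      change p ∈ range sliceEmbed
      rw [E4.mem_range_sliceEmbed_iff]
      simp [hp]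
    refine LorentzianMetric.causalFuture_mono (g := vacuumCauchyDevelopment.metric)
      (singleton_subset_iff.2 hpr) (mem_causalFuture_vacuumCauchyDevelopment ?_)
    rw [stretchChart_apply, hp, E4.spatial_ofTimeSpace, sub_self, norm_zero,
      E4.ofTimeSpace_apply_zero, sub_zero, timeStretch_apply_zero]
    positivity
  · -- flat chart: `Cᵏ` slab deviation `0`
    refine (deviationCk_stretchChart_le 1 k 0).trans (le_of_eq ?_)
    norm_num
  · -- the leaf is the flat slab image (no hole slabs)
    rw [iUnion_of_empty, union_empty]
    rfl
  · -- upper layer in `I⁺(S)` (slide flat points down to the slab)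
    refine union_subset ?_ (iUnion_subset fun i => i.elim0)
    rintro _ ⟨x, hx, rfl⟩
    set c : ℝ := (hypBackground ⊤).time x.1 with hc
    set x' : (hypBackground ⊤).domain := ⟨x.1 - c • E4.basisVector 0, trivial⟩ with hx'
    have hx'0 : (hypBackground ⊤).time x'.1 = 0 := by
      rw [hx', hypTime_sub_smul_basisVector, hc, sub_self]
    have hmem : stretchChart 1 x' ∈ stretchLeaf 1 := ⟨x', hx'0, rfl⟩
    refine LorentzianMetric.chronologicalFuture_mono (g := vacuumCauchyDevelopment.metric)
      (singleton_subset_iff.2 hmem) (mem_chronologicalFuture_of_norm_lt ?_)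
    rw [stretchChart_apply, stretchChart_apply, spatial_timeStretch, spatial_timeStretch, hx',
      map_sub, C0Extension.spatial_smul_basisVector, sub_zero, sub_self, norm_zero,
      timeStretch_apply_zero, timeStretch_apply_zero]
    have : (x.1 - c • E4.basisVector 0) 0 = x.1 0 - c := by simp
    rw [this]
    nlinarith [hx.1]
  · -- barrier clause (honest hyperboloid barrier)
    rintro q ⟨hqE, hqW⟩
    have hqI := ((CauchyDevelopment.mem_exteriorOf_iff _ _ _).1 hqE).2
    refine barrier_hyperboloid
      (LorentzianMetric.chronologicalFuture_mono (g := vacuumCauchyDevelopment.metric) ?_ hqI)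
      fun h => hqW (Or.inl h)
    exact union_subset subset_rfl (iUnion_subset fun i => i.elim0)
  · -- (S₃) layer certification: the identity chart's deviation is the constant `stretchDefect 1 = 0`
    rw [deviationExtend_stretchChart]
    refine (supCkENorm_const_le _ k _).trans (le_of_eq ?_)
    rw [← ofReal_norm, ENNReal.ofReal_eq_zero]
    exact (norm_stretchDefect_le 1).trans (by norm_num)

/-- Hence sound leaves exist: for every `k` and every `ε` the Minkowski development has a sound
`(ε, k)`-near-Kerr leaf with `0` holes. [cite: ONeillSemiRiemannian1983, Ch. 14, p. 413] -/
theorem exists_isSoundNearKerrLeaf (k : ℕ) (ε : ℝ≥0∞) :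
    ∃ S : Set E4, vacuumCauchyDevelopment.toCauchyDevelopment.IsSoundNearKerrLeaf k ε 0 ![] ![] S :=
  ⟨_, (isSoundNearKerrLeaf_hyperboloid k).mono le_rfl bot_le⟩

end Minkowski

end Literature.Geometry.Lorentzian

end
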